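import Mathlib.Tactic.Ring
import Mathlib.Tactic.Linarith
import Mathlib.Tactic.Positivity
import Mathlib.Tactic.LinearCombination
import Mathlib.Analysis.SpecialFunctions.Pow.Real
import Summits.HodgeConjecture.HodgeConjecture.Theorems.WeilClassTestFormatFiveThreeQ2
import Summits.HodgeConjecture.HodgeConjecture.Theorems.WeilClassTestFormatFiveThreeLineQuintic
import Summits.HodgeConjecture.HodgeConjecture.Theorems.WeilClassTestFourBelowFour
import HarnessLib

/-!
# Conjecture N (hodge-weil ladder, GAPS G51b), format (5,3), real charges: THE PATTERNS (0,4,4) AND (1,1,5) BY THE MOMENT METHOD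

Prover 2, generation 18 (note `run/shared/lean/b2b/hodge-weil/b2b-hweil-pv2-g18/MOMENTS-G18.md`); continuation of
`WeilClassTestFormatFiveThreeLineQuintic.lean` / `…EmptyPatterns.lean` (pv2-g17) and `WeilClassTestFourBelowFour.lean` (this seat).
THE MOMENT PICTURE. On the pure locus (centring, P4) the E-charges `u₁..u₅` and the five numbers `v₁, v₂, v₃, ρ, −ρ` (`ρ ≥ 0`,
`ρ² = S/2`) share the power sums `p₁, p₂, p₃`. Two consequences are used here:
* CUBIC TEST (`cubic_test`): for every cubic `h(t) = (t − a)(t − b)(t − c)`, `Σ_e h(u_e) − Σ_g h(v_g) = h(ρ) + h(−ρ)`; so the signed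
  sequence (`+` at E-charges, `−` at `v_g, ±ρ`) has at least four sign changes (Descartes for moment-matched configurations);
* FOUR-BELOW-FOUR (`WeilClassTestFourBelowFour.four_below_four`, a Rolle count): four E-charges below four of `v₁, v₂, v₃, ±ρ` is impossible.
PATTERN (0,4,4) (`no_config_044_of_Q4_neg`): sorted strict pattern `v₁ < u₁ ≤ u₂ ≤ u₃ ≤ u₄ < v₂ ≤ v₃ < u₅` with `Q₄ < 0`. The slope of
the line is negative and `ℓ(v₃) = K₀(3) > 0`, so `ℓ(u_e) > 0` and (wall values) `w(u_e) = u_e² − S/2 > 0` for `e ≤ 4`. If `S < 0` all eight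
walls are positive (`no_config_of_walls_pos`). Else `ρ = √(S/2)`: if `u₄ < −ρ`, four-below-four (below `−ρ, ρ, v₂, v₃`); if `ρ < u₁`, the
cubic test with roots `u₁, v₂, u₅` has LHS `≥ −h(v₁) > 0` and RHS `h(ρ) + h(−ρ) < 0`; otherwise `u₁ < −ρ` and `u₄ > ρ` (their walls
are positive), whence `w(v₁), w(v₂), w(v₃), w(u₅) > 0` too and `no_config_of_walls_pos` ends it. Hence `Glam_nonneg_044` (with pv2-g15's
`conjectureN_53_of_Q4_nonneg` on `Q₄ ≥ 0`) and, by the reflection `u ↦ −u`, `Glam_nonneg_115`: `Q₂ + λQ₄ ≥ 0` for every `λ ≥ 0` on the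
sorted patterns (0,4,4) and (1,1,5) — the two 'four-in-a-gap' patterns left open by pv2-g17 (44/56 strict patterns of real N(5,3)).
Pure real algebra (+ Rolle via the imported lemma); nothing here is a case of HC, a rung or a door edge; no statement of Markman's papers
is used. New cell result ⇒ Summits/.
-/

set_option linter.dupNamespace false

open Summit.HodgeConjecture.HodgeConjecture.WeilClassTestFormatFiveThreeQ2
open Summit.HodgeConjecture.HodgeConjecture.WeilClassTestFormatFiveThreeLineQuintic
open Summit.HodgeConjecture.HodgeConjecture.WeilClassTestFourBelowFour

namespace Summit.HodgeConjecture.HodgeConjecture.WeilClassTestFormatFiveThreePattern044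

/-- THE CUBIC TEST (moment identity): on the pure locus, for every cubic `h(t) = (t − a)(t − b)(t − c)` and every `ρ` with `ρ² = S/2`,
`Σ_e h(u_e) − Σ_g h(v_g) = h(ρ) + h(−ρ)` (the two 5-point configurations `u` and `(v, ρ, −ρ)` share `p₁, p₂, p₃`). -/
theorem cubic_test (u₁ u₂ u₃ u₄ u₅ v₁ v₂ v₃ ρ a b c : ℝ)
    (hC : u₁ + u₂ + u₃ + u₄ + u₅ = v₁ + v₂ + v₃)
    (hP4 : (u₁ ^ 3 + u₂ ^ 3 + u₃ ^ 3 + u₄ ^ 3 + u₅ ^ 3) - (v₁ ^ 3 + v₂ ^ 3 + v₃ ^ 3) = 0)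
    (hρ2 : ρ ^ 2 = ((u₁ ^ 2 + u₂ ^ 2 + u₃ ^ 2 + u₄ ^ 2 + u₅ ^ 2) - (v₁ ^ 2 + v₂ ^ 2 + v₃ ^ 2)) / 2) :
    (((u₁ - a) * (u₁ - b) * (u₁ - c)) + ((u₂ - a) * (u₂ - b) * (u₂ - c)) + ((u₃ - a) * (u₃ - b) * (u₃ - c)) + ((u₄ - a) * (u₄ - b) * (u₄ - c)) + ((u₅ - a) * (u₅ - b) * (u₅ - c)))
      - (((v₁ - a) * (v₁ - b) * (v₁ - c)) + ((v₂ - a) * (v₂ - b) * (v₂ - c)) + ((v₃ - a) * (v₃ - b) * (v₃ - c)))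
      = ((ρ - a) * (ρ - b) * (ρ - c)) + (((-ρ) - a) * ((-ρ) - b) * ((-ρ) - c)) := by
  linear_combination hP4 + (2 * (a + b + c)) * hρ2 + (a * b + b * c + a * c) * hC

/-- sign helper: `0 < x·y` and `0 < y` give `0 < x`. -/
theorem pos_of_mul_pos_of_pos_right (x y : ℝ) (h : 0 < x * y) (hy : 0 < y) : 0 < x := by nlinarith

/-- sign helper: `0 ≤ a`, `b ≤ 0`, `c ≤ 0` give `0 ≤ a·b·c`. -/
theorem prod3_nonneg_pnn (a b c : ℝ) (ha : 0 ≤ a) (hb : b ≤ 0) (hc : c ≤ 0) : 0 ≤ a * b * c :=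
  mul_nonneg_of_nonpos_of_nonpos (mul_nonpos_of_nonneg_of_nonpos ha hb) hc

/-- sign helper: `a, b, c < 0` give `a·b·c < 0`. -/
theorem prod3_neg_nnn (a b c : ℝ) (ha : a < 0) (hb : b < 0) (hc : c < 0) : a * b * c < 0 :=
  mul_neg_of_pos_of_neg (mul_pos_of_neg_of_neg ha hb) hc

/-- sign helper: `0 ≤ a`, `0 ≤ b`, `c ≤ 0` give `a·b·c ≤ 0`. -/
theorem prod3_nonpos_ppn (a b c : ℝ) (ha : 0 ≤ a) (hb : 0 ≤ b) (hc : c ≤ 0) : a * b * c ≤ 0 :=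
  mul_nonpos_of_nonneg_of_nonpos (mul_nonneg ha hb) hc

/-- wall helper: with `ρ ≥ 0`, `ρ² = S/2`: a charge `x` outside `[−ρ, ρ]` (i.e. `x < −ρ` or `ρ < x`) has a positive wall `x² − S/2`. -/
theorem wall_pos_of_lt_neg (x ρ s : ℝ) (hρ : 0 ≤ ρ) (hρ2 : ρ ^ 2 = s / 2) (hx : x < -ρ) : 0 < x ^ 2 - s / 2 := by
  have e : x ^ 2 - s / 2 = (-x - ρ) * (-x + ρ) := by linear_combination hρ2
  rw [e]; exact mul_pos (by linarith) (by linarith)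

/-- wall helper (mirror): `ρ < x` gives a positive wall. -/
theorem wall_pos_of_gt (x ρ s : ℝ) (hρ : 0 ≤ ρ) (hρ2 : ρ ^ 2 = s / 2) (hx : ρ < x) : 0 < x ^ 2 - s / 2 := by
  have e : x ^ 2 - s / 2 = (x - ρ) * (x + ρ) := by linear_combination hρ2
  rw [e]; exact mul_pos (by linarith) (by linarith)

/-- wall helper: a positive wall with `x ≤ ρ` forces `x < −ρ`. -/
theorem lt_neg_of_wall_pos (x ρ s : ℝ) (hρ2 : ρ ^ 2 = s / 2) (hw : 0 < x ^ 2 - s / 2) (hx : x ≤ ρ) : x < -ρ := by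
  by_contra hc
  have hc' := not_lt.mp hc
  have e : x ^ 2 - s / 2 = -((ρ - x) * (x + ρ)) := by linear_combination hρ2
  have : 0 ≤ (ρ - x) * (x + ρ) := mul_nonneg (by linarith) (by linarith)
  linarith

/-- wall helper: a positive wall with `−ρ ≤ x` forces `ρ < x`. -/
theorem gt_of_wall_pos (x ρ s : ℝ) (hρ2 : ρ ^ 2 = s / 2) (hw : 0 < x ^ 2 - s / 2) (hx : -ρ ≤ x) : ρ < x := by
  by_contra hc
  have hc' := not_lt.mp hc
  have e : x ^ 2 - s / 2 = -((ρ - x) * (x + ρ)) := by linear_combination hρ2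
  have : 0 ≤ (ρ - x) * (x + ρ) := mul_nonneg (by linarith) (by linarith)
  linarith

set_option maxHeartbeats 1600000 in
/-- THE PATTERN (0,4,4) WITH `Q₄ < 0` IS EMPTY: no centred (5,3) configuration with `P2 = P4 = 0`, pairwise ample, has sorted charges
`v₁ < u₁ ≤ u₂ ≤ u₃ ≤ u₄ < v₂ ≤ v₃ < u₅` and `Q₄ < 0`. (Moment method: negative slope ⟹ `w(u_e) > 0` for `e ≤ 4`; then `S < 0` ⟹ all walls
positive; `u₄ < −ρ` ⟹ four-below-four; `ρ < u₁` ⟹ cubic test with roots `u₁, v₂, u₅`; otherwise all walls positive. P1 is not used.) -/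
theorem no_config_044_of_Q4_neg (A₁ A₂ A₃ A₄ A₅ B₁ B₂ B₃ u₁ u₂ u₃ u₄ u₅ v₁ v₂ v₃ : ℝ)
    (hA : A₁ + A₂ + A₃ + A₄ + A₅ = B₁ + B₂ + B₃) (hC : u₁ + u₂ + u₃ + u₄ + u₅ = v₁ + v₂ + v₃)
    (hP2 : (A₁ * u₁ ^ 2 + A₂ * u₂ ^ 2 + A₃ * u₃ ^ 2 + A₄ * u₄ ^ 2 + A₅ * u₅ ^ 2) - (B₁ * v₁ ^ 2 + B₂ * v₂ ^ 2 + B₃ * v₃ ^ 2) = 0)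
    (hP4 : (u₁ ^ 3 + u₂ ^ 3 + u₃ ^ 3 + u₄ ^ 3 + u₅ ^ 3) - (v₁ ^ 3 + v₂ ^ 3 + v₃ ^ 3) = 0)
    (m₁₁ : |u₁ - v₁| ≤ A₁ - B₁) (m₂₁ : |u₂ - v₁| ≤ A₂ - B₁) (m₃₁ : |u₃ - v₁| ≤ A₃ - B₁) (m₄₁ : |u₄ - v₁| ≤ A₄ - B₁) (m₅₁ : |u₅ - v₁| ≤ A₅ - B₁)
    (m₁₂ : |u₁ - v₂| ≤ A₁ - B₂) (m₂₂ : |u₂ - v₂| ≤ A₂ - B₂) (m₃₂ : |u₃ - v₂| ≤ A₃ - B₂) (m₄₂ : |u₄ - v₂| ≤ A₄ - B₂) (m₅₂ : |u₅ - v₂| ≤ A₅ - B₂)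
    (m₁₃ : |u₁ - v₃| ≤ A₁ - B₃) (m₂₃ : |u₂ - v₃| ≤ A₂ - B₃) (m₃₃ : |u₃ - v₃| ≤ A₃ - B₃) (m₄₃ : |u₄ - v₃| ≤ A₄ - B₃) (m₅₃ : |u₅ - v₃| ≤ A₅ - B₃)
    (h₁ : v₁ < u₁) (h₁₂ : u₁ ≤ u₂) (h₂₃ : u₂ ≤ u₃) (h₃₄ : u₃ ≤ u₄) (h₄ : u₄ < v₂) (hv₂₃ : v₂ ≤ v₃) (h₅ : v₃ < u₅)
    (hQ4 : 3 * ((u₁ ^ 4 + u₂ ^ 4 + u₃ ^ 4 + u₄ ^ 4 + u₅ ^ 4) - (v₁ ^ 4 + v₂ ^ 4 + v₃ ^ 4)) - (3 / 2) * ((u₁ ^ 2 + u₂ ^ 2 + u₃ ^ 2 + u₄ ^ 2 + u₅ ^ 2) - (v₁ ^ 2 + v₂ ^ 2 + v₃ ^ 2)) ^ 2 < 0) :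
    False := by
  -- the slope is negative
  have hσ : (-((u₁ * u₂ * u₃ * u₄ + u₁ * u₂ * u₃ * u₅ + u₁ * u₂ * u₄ * u₅ + u₁ * u₃ * u₄ * u₅ + u₂ * u₃ * u₄ * u₅) + (v₁ * v₂ + v₁ * v₃ + v₂ * v₃) * ((u₁ ^ 2 + u₂ ^ 2 + u₃ ^ 2 + u₄ ^ 2 + u₅ ^ 2) - (v₁ ^ 2 + v₂ ^ 2 + v₃ ^ 2)) / 2)) < 0 := by
    have e := Q4_eq_slope u₁ u₂ u₃ u₄ u₅ v₁ v₂ v₃ hC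
    rw [hP4] at e
    linarith only [e, hQ4]
  -- K₀(3) = ℓ(v₃) > 0
  have a₁ : u₁ - v₃ < 0 := by linarith only [h₁, h₁₂, h₂₃, h₃₄, h₄, hv₂₃, h₅]
  have a₂ : u₂ - v₃ < 0 := by linarith only [h₁, h₁₂, h₂₃, h₃₄, h₄, hv₂₃, h₅]
  have a₃ : u₃ - v₃ < 0 := by linarith only [h₁, h₁₂, h₂₃, h₃₄, h₄, hv₂₃, h₅]
  have a₄ : u₄ - v₃ < 0 := by linarith only [h₁, h₁₂, h₂₃, h₃₄, h₄, hv₂₃, h₅]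
  have a₅ : 0 < u₅ - v₃ := by linarith only [h₁, h₁₂, h₂₃, h₃₄, h₄, hv₂₃, h₅]
  have hK3 : 0 < (u₁ - v₃) * (u₂ - v₃) * (u₃ - v₃) * (u₄ - v₃) * (u₅ - v₃) :=
    mul_pos (mul_pos_of_neg_of_neg (mul_neg_of_pos_of_neg (mul_pos_of_neg_of_neg a₁ a₂) a₃) a₄) a₅
  have hl3 := K0_eq_line₃ u₁ u₂ u₃ u₄ u₅ v₁ v₂ v₃ hC hP4
  -- ℓ(u₁) > 0, C(u₁) > 0, wall of u₁ positive
  have el1 : (((u₁ * u₂ * u₃ * u₄ * u₅) + (v₁ * v₂ * v₃) * ((u₁ ^ 2 + u₂ ^ 2 + u₃ ^ 2 + u₄ ^ 2 + u₅ ^ 2) - (v₁ ^ 2 + v₂ ^ 2 + v₃ ^ 2)) / 2) + (-((u₁ * u₂ * u₃ * u₄ + u₁ * u₂ * u₃ * u₅ + u₁ * u₂ * u₄ * u₅ + u₁ * u₃ * u₄ * u₅ + u₂ * u₃ * u₄ * u₅) + (v₁ * v₂ + v₁ * v₃ + v₂ * v₃) * ((u₁ ^ 2 + u₂ ^ 2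 + u₃ ^ 2 + u₄ ^ 2 + u₅ ^ 2) - (v₁ ^ 2 + v₂ ^ 2 + v₃ ^ 2)) / 2)) * u₁) = (((u₁ * u₂ * u₃ * u₄ * u₅) + (v₁ * v₂ * v₃) * ((u₁ ^ 2 + u₂ ^ 2 + u₃ ^ 2 + u₄ ^ 2 + u₅ ^ 2) - (v₁ ^ 2 + v₂ ^ 2 + v₃ ^ 2)) / 2) + (-((u₁ * u₂ * u₃ * u₄ + u₁ * u₂ * u₃ * u₅ + u₁ * u₂ * u₄ * u₅ + u₁ * u₃ * u₄ * u₅ + u₂ * u₃ * u₄ * u₅) + (v₁ * v₂ + v₁ * v₃ + v₂ * v₃) * ((u₁ ^ 2 + u₂ ^ 2 + u₃ ^ 2 + u₄ ^ 2 + u₅ ^ 2) - (v₁ ^ 2 + v₂ ^ 2 + v₃ ^ 2)) / 2)) * v₃) + (-((u₁ * u₂ * u₃ * u₄ + u₁ * u₂ * u₃ * u₅ + u₁ * u₂ * u₄ * u₅ + u₁ * u₃ * u₄ * u₅ + u₂ * u₃ * u₄ * u₅) + (v₁ * v₂ + v₁ * v₃ + v₂ * v₃) * ((u₁ ^ 2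 + u₂ ^ 2 + u₃ ^ 2 + u₄ ^ 2 + u₅ ^ 2) - (v₁ ^ 2 + v₂ ^ 2 + v₃ ^ 2)) / 2)) * (u₁ - v₃) := by ring
  have hlu1 : 0 < (((u₁ * u₂ * u₃ * u₄ * u₅) + (v₁ * v₂ * v₃) * ((u₁ ^ 2 + u₂ ^ 2 + u₃ ^ 2 + u₄ ^ 2 + u₅ ^ 2) - (v₁ ^ 2 + v₂ ^ 2 + v₃ ^ 2)) / 2) + (-((u₁ * u₂ * u₃ * u₄ + u₁ * u₂ * u₃ * u₅ + u₁ * u₂ * u₄ * u₅ + u₁ * u₃ * u₄ * u₅ + u₂ * u₃ * u₄ * u₅) + (v₁ * v₂ + v₁ * v₃ + v₂ * v₃) * ((u₁ ^ 2 + u₂ ^ 2 + u₃ ^ 2 + u₄ ^ 2 + u₅ ^ 2) - (v₁ ^ 2 + v₂ ^ 2 + v₃ ^ 2)) / 2)) * u₁) := by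
    rw [el1, ← hl3]; exact add_pos hK3 (mul_pos_of_neg_of_neg hσ a₁)
  have hC1 : 0 < ((u₁ - v₁) * (u₁ - v₂) * (u₁ - v₃)) := mul_pos_of_neg_of_neg (mul_neg_of_pos_of_neg (by linarith only [h₁, h₁₂, h₂₃, h₃₄, h₄, hv₂₃, h₅]) (by linarith only [h₁, h₁₂, h₂₃, h₃₄, h₄, hv₂₃, h₅])) a₁
  have hw₁ : 0 < (u₁ ^ 2 - ((u₁ ^ 2 + u₂ ^ 2 + u₃ ^ 2 + u₄ ^ 2 + u₅ ^ 2) - (v₁ ^ 2 + v₂ ^ 2 + v₃ ^ 2)) / 2) := by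
    have hq := wall_eq_line₁ u₁ u₂ u₃ u₄ u₅ v₁ v₂ v₃ hC hP4
    have h : 0 < (u₁ ^ 2 - ((u₁ ^ 2 + u₂ ^ 2 + u₃ ^ 2 + u₄ ^ 2 + u₅ ^ 2) - (v₁ ^ 2 + v₂ ^ 2 + v₃ ^ 2)) / 2) * ((u₁ - v₁) * (u₁ - v₂) * (u₁ - v₃)) := by rw [hq]; exact hlu1
    exact pos_of_mul_pos_of_pos_right _ _ h hC1
  -- ℓ(u₂) > 0, C(u₂) > 0, wall of u₂ positive
  have el2 : (((u₁ * u₂ * u₃ * u₄ * u₅) + (v₁ * v₂ * v₃) * ((u₁ ^ 2 + u₂ ^ 2 + u₃ ^ 2 + u₄ ^ 2 + u₅ ^ 2) - (v₁ ^ 2 + v₂ ^ 2 + v₃ ^ 2)) / 2) + (-((u₁ * u₂ * u₃ * u₄ + u₁ * u₂ * u₃ * u₅ + u₁ * u₂ * u₄ * u₅ + u₁ * u₃ * u₄ * u₅ + u₂ * u₃ * u₄ * u₅) + (v₁ * v₂ + v₁ * v₃ + v₂ * v₃) * ((u₁ ^ 2 + u₂ ^ 2 + u₃ ^ 2 + u₄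 ^ 2 + u₅ ^ 2) - (v₁ ^ 2 + v₂ ^ 2 + v₃ ^ 2)) / 2)) * u₂) = (((u₁ * u₂ * u₃ * u₄ * u₅) + (v₁ * v₂ * v₃) * ((u₁ ^ 2 + u₂ ^ 2 + u₃ ^ 2 + u₄ ^ 2 + u₅ ^ 2) - (v₁ ^ 2 + v₂ ^ 2 + v₃ ^ 2)) / 2) + (-((u₁ * u₂ * u₃ * u₄ + u₁ * u₂ * u₃ * u₅ + u₁ * u₂ * u₄ * u₅ + u₁ * u₃ * u₄ * u₅ + u₂ * u₃ * u₄ * u₅) + (v₁ * v₂ + v₁ * v₃ + v₂ * v₃) * ((u₁ ^ 2 + u₂ ^ 2 + u₃ ^ 2 + u₄ ^ 2 + u₅ ^ 2) - (v₁ ^ 2 + v₂ ^ 2 + v₃ ^ 2)) / 2)) * v₃) + (-((u₁ * u₂ * u₃ * u₄ + u₁ * u₂ * u₃ * u₅ + u₁ * u₂ * u₄ * u₅ + u₁ * u₃ * u₄ * u₅ + u₂ * u₃ * u₄ * u₅) + (v₁ * v₂ + v₁ * v₃ + v₂ * v₃) * ((u₁ ^ 2 + u₂ ^ 2 + u₃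 ^ 2 + u₄ ^ 2 + u₅ ^ 2) - (v₁ ^ 2 + v₂ ^ 2 + v₃ ^ 2)) / 2)) * (u₂ - v₃) := by ring
  have hlu2 : 0 < (((u₁ * u₂ * u₃ * u₄ * u₅) + (v₁ * v₂ * v₃) * ((u₁ ^ 2 + u₂ ^ 2 + u₃ ^ 2 + u₄ ^ 2 + u₅ ^ 2) - (v₁ ^ 2 + v₂ ^ 2 + v₃ ^ 2)) / 2) + (-((u₁ * u₂ * u₃ * u₄ + u₁ * u₂ * u₃ * u₅ + u₁ * u₂ * u₄ * u₅ + u₁ * u₃ * u₄ * u₅ + u₂ * u₃ * u₄ * u₅) + (v₁ * v₂ + v₁ * v₃ + v₂ * v₃) * ((u₁ ^ 2 + u₂ ^ 2 + u₃ ^ 2 + u₄ ^ 2 + u₅ ^ 2) - (v₁ ^ 2 + v₂ ^ 2 + v₃ ^ 2)) / 2)) * u₂) := by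
    rw [el2, ← hl3]; exact add_pos hK3 (mul_pos_of_neg_of_neg hσ a₂)
  have hC2 : 0 < ((u₂ - v₁) * (u₂ - v₂) * (u₂ - v₃)) := mul_pos_of_neg_of_neg (mul_neg_of_pos_of_neg (by linarith only [h₁, h₁₂, h₂₃, h₃₄, h₄, hv₂₃, h₅]) (by linarith only [h₁, h₁₂, h₂₃, h₃₄, h₄, hv₂₃, h₅])) a₂
  have hw₂ : 0 < (u₂ ^ 2 - ((u₁ ^ 2 + u₂ ^ 2 + u₃ ^ 2 + u₄ ^ 2 + u₅ ^ 2) - (v₁ ^ 2 + v₂ ^ 2 + v₃ ^ 2)) / 2) := by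
    have hq := wall_eq_line₂ u₁ u₂ u₃ u₄ u₅ v₁ v₂ v₃ hC hP4
    have h : 0 < (u₂ ^ 2 - ((u₁ ^ 2 + u₂ ^ 2 + u₃ ^ 2 + u₄ ^ 2 + u₅ ^ 2) - (v₁ ^ 2 + v₂ ^ 2 + v₃ ^ 2)) / 2) * ((u₂ - v₁) * (u₂ - v₂) * (u₂ - v₃)) := by rw [hq]; exact hlu2
    exact pos_of_mul_pos_of_pos_right _ _ h hC2
  -- ℓ(u₃) > 0, C(u₃) > 0, wall of u₃ positive
  have el3 : (((u₁ * u₂ * u₃ * u₄ * u₅) + (v₁ * v₂ * v₃) * ((u₁ ^ 2 + u₂ ^ 2 + u₃ ^ 2 + u₄ ^ 2 + u₅ ^ 2) - (v₁ ^ 2 + v₂ ^ 2 + v₃ ^ 2)) / 2) + (-((u₁ * u₂ * u₃ * u₄ + u₁ * u₂ * u₃ * u₅ + u₁ * u₂ * u₄ * u₅ + u₁ * u₃ * u₄ * u₅ + u₂ * u₃ * u₄ * u₅) + (v₁ * v₂ + v₁ * v₃ + v₂ * v₃) * ((u₁ ^ 2 + u₂ ^ 2 + u₃ ^ 2 + u₄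 ^ 2 + u₅ ^ 2) - (v₁ ^ 2 + v₂ ^ 2 + v₃ ^ 2)) / 2)) * u₃) = (((u₁ * u₂ * u₃ * u₄ * u₅) + (v₁ * v₂ * v₃) * ((u₁ ^ 2 + u₂ ^ 2 + u₃ ^ 2 + u₄ ^ 2 + u₅ ^ 2) - (v₁ ^ 2 + v₂ ^ 2 + v₃ ^ 2)) / 2) + (-((u₁ * u₂ * u₃ * u₄ + u₁ * u₂ * u₃ * u₅ + u₁ * u₂ * u₄ * u₅ + u₁ * u₃ * u₄ * u₅ + u₂ * u₃ * u₄ * u₅) + (v₁ * v₂ + v₁ * v₃ + v₂ * v₃) * ((u₁ ^ 2 + u₂ ^ 2 + u₃ ^ 2 + u₄ ^ 2 + u₅ ^ 2) - (v₁ ^ 2 + v₂ ^ 2 + v₃ ^ 2)) / 2)) * v₃) + (-((u₁ * u₂ * u₃ * u₄ + u₁ * u₂ * u₃ * u₅ + u₁ * u₂ * u₄ * u₅ + u₁ * u₃ * u₄ * u₅ + u₂ * u₃ * u₄ * u₅) + (v₁ * v₂ + v₁ * v₃ + v₂ * v₃) * ((u₁ ^ 2 + u₂ ^ 2 + u₃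 ^ 2 + u₄ ^ 2 + u₅ ^ 2) - (v₁ ^ 2 + v₂ ^ 2 + v₃ ^ 2)) / 2)) * (u₃ - v₃) := by ring
  have hlu3 : 0 < (((u₁ * u₂ * u₃ * u₄ * u₅) + (v₁ * v₂ * v₃) * ((u₁ ^ 2 + u₂ ^ 2 + u₃ ^ 2 + u₄ ^ 2 + u₅ ^ 2) - (v₁ ^ 2 + v₂ ^ 2 + v₃ ^ 2)) / 2) + (-((u₁ * u₂ * u₃ * u₄ + u₁ * u₂ * u₃ * u₅ + u₁ * u₂ * u₄ * u₅ + u₁ * u₃ * u₄ * u₅ + u₂ * u₃ * u₄ * u₅) + (v₁ * v₂ + v₁ * v₃ + v₂ * v₃) * ((u₁ ^ 2 + u₂ ^ 2 + u₃ ^ 2 + u₄ ^ 2 + u₅ ^ 2) - (v₁ ^ 2 + v₂ ^ 2 + v₃ ^ 2)) / 2)) * u₃) := by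
    rw [el3, ← hl3]; exact add_pos hK3 (mul_pos_of_neg_of_neg hσ a₃)
  have hC3 : 0 < ((u₃ - v₁) * (u₃ - v₂) * (u₃ - v₃)) := mul_pos_of_neg_of_neg (mul_neg_of_pos_of_neg (by linarith only [h₁, h₁₂, h₂₃, h₃₄, h₄, hv₂₃, h₅]) (by linarith only [h₁, h₁₂, h₂₃, h₃₄, h₄, hv₂₃, h₅])) a₃
  have hw₃ : 0 < (u₃ ^ 2 - ((u₁ ^ 2 + u₂ ^ 2 + u₃ ^ 2 + u₄ ^ 2 + u₅ ^ 2) - (v₁ ^ 2 + v₂ ^ 2 + v₃ ^ 2)) / 2) := by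
    have hq := wall_eq_line₃ u₁ u₂ u₃ u₄ u₅ v₁ v₂ v₃ hC hP4
    have h : 0 < (u₃ ^ 2 - ((u₁ ^ 2 + u₂ ^ 2 + u₃ ^ 2 + u₄ ^ 2 + u₅ ^ 2) - (v₁ ^ 2 + v₂ ^ 2 + v₃ ^ 2)) / 2) * ((u₃ - v₁) * (u₃ - v₂) * (u₃ - v₃)) := by rw [hq]; exact hlu3
    exact pos_of_mul_pos_of_pos_right _ _ h hC3
  -- ℓ(u₄) > 0, C(u₄) > 0, wall of u₄ positive
  have el4 : (((u₁ * u₂ * u₃ * u₄ * u₅) + (v₁ * v₂ * v₃) * ((u₁ ^ 2 + u₂ ^ 2 + u₃ ^ 2 + u₄ ^ 2 + u₅ ^ 2) - (v₁ ^ 2 + v₂ ^ 2 + v₃ ^ 2)) / 2) + (-((u₁ * u₂ * u₃ * u₄ + u₁ * u₂ * u₃ * u₅ + u₁ * u₂ * u₄ * u₅ + u₁ * u₃ * u₄ * u₅ + u₂ * u₃ * u₄ * u₅) + (v₁ * v₂ + v₁ * v₃ + v₂ * v₃) * ((u₁ ^ 2 + u₂ ^ 2 + u₃ ^ 2 + u₄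 ^ 2 + u₅ ^ 2) - (v₁ ^ 2 + v₂ ^ 2 + v₃ ^ 2)) / 2)) * u₄) = (((u₁ * u₂ * u₃ * u₄ * u₅) + (v₁ * v₂ * v₃) * ((u₁ ^ 2 + u₂ ^ 2 + u₃ ^ 2 + u₄ ^ 2 + u₅ ^ 2) - (v₁ ^ 2 + v₂ ^ 2 + v₃ ^ 2)) / 2) + (-((u₁ * u₂ * u₃ * u₄ + u₁ * u₂ * u₃ * u₅ + u₁ * u₂ * u₄ * u₅ + u₁ * u₃ * u₄ * u₅ + u₂ * u₃ * u₄ * u₅) + (v₁ * v₂ + v₁ * v₃ + v₂ * v₃) * ((u₁ ^ 2 + u₂ ^ 2 + u₃ ^ 2 + u₄ ^ 2 + u₅ ^ 2) - (v₁ ^ 2 + v₂ ^ 2 + v₃ ^ 2)) / 2)) * v₃) + (-((u₁ * u₂ * u₃ * u₄ + u₁ * u₂ * u₃ * u₅ + u₁ * u₂ * u₄ * u₅ + u₁ * u₃ * u₄ * u₅ + u₂ * u₃ * u₄ * u₅) + (v₁ * v₂ + v₁ * v₃ + v₂ * v₃) * ((u₁ ^ 2 + u₂ ^ 2 + u₃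 ^ 2 + u₄ ^ 2 + u₅ ^ 2) - (v₁ ^ 2 + v₂ ^ 2 + v₃ ^ 2)) / 2)) * (u₄ - v₃) := by ring
  have hlu4 : 0 < (((u₁ * u₂ * u₃ * u₄ * u₅) + (v₁ * v₂ * v₃) * ((u₁ ^ 2 + u₂ ^ 2 + u₃ ^ 2 + u₄ ^ 2 + u₅ ^ 2) - (v₁ ^ 2 + v₂ ^ 2 + v₃ ^ 2)) / 2) + (-((u₁ * u₂ * u₃ * u₄ + u₁ * u₂ * u₃ * u₅ + u₁ * u₂ * u₄ * u₅ + u₁ * u₃ * u₄ * u₅ + u₂ * u₃ * u₄ * u₅) + (v₁ * v₂ + v₁ * v₃ + v₂ * v₃) * ((u₁ ^ 2 + u₂ ^ 2 + u₃ ^ 2 + u₄ ^ 2 + u₅ ^ 2) - (v₁ ^ 2 + v₂ ^ 2 + v₃ ^ 2)) / 2)) * u₄) := by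
    rw [el4, ← hl3]; exact add_pos hK3 (mul_pos_of_neg_of_neg hσ a₄)
  have hC4 : 0 < ((u₄ - v₁) * (u₄ - v₂) * (u₄ - v₃)) := mul_pos_of_neg_of_neg (mul_neg_of_pos_of_neg (by linarith only [h₁, h₁₂, h₂₃, h₃₄, h₄, hv₂₃, h₅]) (by linarith only [h₁, h₁₂, h₂₃, h₃₄, h₄, hv₂₃, h₅])) a₄
  have hw₄ : 0 < (u₄ ^ 2 - ((u₁ ^ 2 + u₂ ^ 2 + u₃ ^ 2 + u₄ ^ 2 + u₅ ^ 2) - (v₁ ^ 2 + v₂ ^ 2 + v₃ ^ 2)) / 2) := by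
    have hq := wall_eq_line₄ u₁ u₂ u₃ u₄ u₅ v₁ v₂ v₃ hC hP4
    have h : 0 < (u₄ ^ 2 - ((u₁ ^ 2 + u₂ ^ 2 + u₃ ^ 2 + u₄ ^ 2 + u₅ ^ 2) - (v₁ ^ 2 + v₂ ^ 2 + v₃ ^ 2)) / 2) * ((u₄ - v₁) * (u₄ - v₂) * (u₄ - v₃)) := by rw [hq]; exact hlu4
    exact pos_of_mul_pos_of_pos_right _ _ h hC4
  rcases lt_or_ge ((u₁ ^ 2 + u₂ ^ 2 + u₃ ^ 2 + u₄ ^ 2 + u₅ ^ 2) - (v₁ ^ 2 + v₂ ^ 2 + v₃ ^ 2)) 0 with hSneg | hSnn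
  · -- S < 0 : every wall x² − S/2 is positive
    have hw₅ : 0 < (u₅ ^ 2 - ((u₁ ^ 2 + u₂ ^ 2 + u₃ ^ 2 + u₄ ^ 2 + u₅ ^ 2) - (v₁ ^ 2 + v₂ ^ 2 + v₃ ^ 2)) / 2) := by linarith only [sq_nonneg u₅, hSneg]
    have hz₁ : 0 < (v₁ ^ 2 - ((u₁ ^ 2 + u₂ ^ 2 + u₃ ^ 2 + u₄ ^ 2 + u₅ ^ 2) - (v₁ ^ 2 + v₂ ^ 2 + v₃ ^ 2)) / 2) := by linarith only [sq_nonneg v₁, hSneg]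
    have hz₂ : 0 < (v₂ ^ 2 - ((u₁ ^ 2 + u₂ ^ 2 + u₃ ^ 2 + u₄ ^ 2 + u₅ ^ 2) - (v₁ ^ 2 + v₂ ^ 2 + v₃ ^ 2)) / 2) := by linarith only [sq_nonneg v₂, hSneg]
    have hz₃ : 0 < (v₃ ^ 2 - ((u₁ ^ 2 + u₂ ^ 2 + u₃ ^ 2 + u₄ ^ 2 + u₅ ^ 2) - (v₁ ^ 2 + v₂ ^ 2 + v₃ ^ 2)) / 2) := by linarith only [sq_nonneg v₃, hSneg]
    exact no_config_of_walls_pos A₁ A₂ A₃ A₄ A₅ B₁ B₂ B₃ u₁ u₂ u₃ u₄ u₅ v₁ v₂ v₃ hA hP2 m₁₁ m₂₁ m₃₁ m₄₁ m₅₁ m₁₂ m₂₂ m₃₂ m₄₂ m₅₂ m₁₃ m₂₃ m₃₃ m₄₃ m₅₃ hw₁ hw₂ hw₃ hw₄ hw₅ hz₁ hz₂ hz₃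
  · -- S ≥ 0 : ρ = √(S/2)
    obtain ⟨ρ, hρ, hρ2⟩ : ∃ ρ : ℝ, 0 ≤ ρ ∧ ρ ^ 2 = ((u₁ ^ 2 + u₂ ^ 2 + u₃ ^ 2 + u₄ ^ 2 + u₅ ^ 2) - (v₁ ^ 2 + v₂ ^ 2 + v₃ ^ 2)) / 2 :=
      ⟨Real.sqrt (((u₁ ^ 2 + u₂ ^ 2 + u₃ ^ 2 + u₄ ^ 2 + u₅ ^ 2) - (v₁ ^ 2 + v₂ ^ 2 + v₃ ^ 2)) / 2), Real.sqrt_nonneg _, Real.sq_sqrt (by linarith only [hSnn])⟩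
    rcases lt_or_ge u₄ (-ρ) with hu4 | hu4
    · -- u₁..u₄ < −ρ ≤ ρ and < v₂ ≤ v₃ : four below four
      exact four_below_four u₁ u₂ u₃ u₄ u₅ v₁ (-ρ) ρ v₂ v₃ h₁₂ h₂₃ h₃₄ hu4 (by linarith only [hu4, hρ]) h₄ (by linarith only [h₄, hv₂₃])
        (by linarith only [hC]) (by linear_combination (-2 : ℝ) * hρ2) (by linear_combination hP4)
    · rcases lt_or_ge ρ u₁ with hu1 | hu1
      · -- ±ρ < u₁ : the cubic test with roots u₁, v₂, u₅
        have hid := cubic_test u₁ u₂ u₃ u₄ u₅ v₁ v₂ v₃ ρ u₁ v₂ u₅ hC hP4 hρ2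
        have z1 : ((u₁ - u₁) * (u₁ - v₂) * (u₁ - u₅)) = 0 := by ring
        have z5 : ((u₅ - u₁) * (u₅ - v₂) * (u₅ - u₅)) = 0 := by ring
        have zv : ((v₂ - u₁) * (v₂ - v₂) * (v₂ - u₅)) = 0 := by ring
        have t2 : 0 ≤ ((u₂ - u₁) * (u₂ - v₂) * (u₂ - u₅)) := prod3_nonneg_pnn _ _ _ (by linarith only [h₁, h₁₂, h₂₃, h₃₄, h₄, hv₂₃, h₅, hu1, hρ]) (by linarith only [h₁, h₁₂, h₂₃, h₃₄, h₄, hv₂₃, h₅, hu1, hρ]) (by linarith only [h₁, h₁₂, h₂₃, h₃₄, h₄, hv₂₃, h₅, hu1, hρ])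
        have t3 : 0 ≤ ((u₃ - u₁) * (u₃ - v₂) * (u₃ - u₅)) := prod3_nonneg_pnn _ _ _ (by linarith only [h₁, h₁₂, h₂₃, h₃₄, h₄, hv₂₃, h₅, hu1, hρ]) (by linarith only [h₁, h₁₂, h₂₃, h₃₄, h₄, hv₂₃, h₅, hu1, hρ]) (by linarith only [h₁, h₁₂, h₂₃, h₃₄, h₄, hv₂₃, h₅, hu1, hρ])
        have t4 : 0 ≤ ((u₄ - u₁) * (u₄ - v₂) * (u₄ - u₅)) := prod3_nonneg_pnn _ _ _ (by linarith only [h₁, h₁₂, h₂₃, h₃₄, h₄, hv₂₃, h₅, hu1, hρ]) (by linarith only [h₁, h₁₂, h₂₃, h₃₄, h₄, hv₂₃, h₅, hu1, hρ]) (by linarith only [h₁, h₁₂, h₂₃, h₃₄, h₄, hv₂₃, h₅, hu1, hρ])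
        have s1 : ((v₁ - u₁) * (v₁ - v₂) * (v₁ - u₅)) < 0 := prod3_neg_nnn _ _ _ (by linarith only [h₁, h₁₂, h₂₃, h₃₄, h₄, hv₂₃, h₅, hu1, hρ]) (by linarith only [h₁, h₁₂, h₂₃, h₃₄, h₄, hv₂₃, h₅, hu1, hρ]) (by linarith only [h₁, h₁₂, h₂₃, h₃₄, h₄, hv₂₃, h₅, hu1, hρ])
        have s3 : ((v₃ - u₁) * (v₃ - v₂) * (v₃ - u₅)) ≤ 0 := prod3_nonpos_ppn _ _ _ (by linarith only [h₁, h₁₂, h₂₃, h₃₄, h₄, hv₂₃, h₅, hu1, hρ]) (by linarith only [h₁, h₁₂, h₂₃, h₃₄, h₄, hv₂₃, h₅, hu1, hρ]) (by linarith only [h₁, h₁₂, h₂₃, h₃₄, h₄, hv₂₃, h₅, hu1, hρ])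
        have r1 : ((ρ - u₁) * (ρ - v₂) * (ρ - u₅)) < 0 := prod3_neg_nnn _ _ _ (by linarith only [h₁, h₁₂, h₂₃, h₃₄, h₄, hv₂₃, h₅, hu1, hρ]) (by linarith only [h₁, h₁₂, h₂₃, h₃₄, h₄, hv₂₃, h₅, hu1, hρ]) (by linarith only [h₁, h₁₂, h₂₃, h₃₄, h₄, hv₂₃, h₅, hu1, hρ])
        have r2 : (((-ρ) - u₁) * ((-ρ) - v₂) * ((-ρ) - u₅)) < 0 := prod3_neg_nnn _ _ _ (by linarith only [h₁, h₁₂, h₂₃, h₃₄, h₄, hv₂₃, h₅, hu1, hρ]) (by linarith only [h₁, h₁₂, h₂₃, h₃₄, h₄, hv₂₃, h₅, hu1, hρ]) (by linarith only [h₁, h₁₂, h₂₃, h₃₄, h₄, hv₂₃, h₅, hu1, hρ])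
        linarith only [hid, z1, z5, zv, t2, t3, t4, s1, s3, r1, r2]
      · -- u₁ ≤ ρ and −ρ ≤ u₄ : then u₁ < −ρ, u₄ > ρ, and all eight walls are positive
        have hu1' : u₁ < -ρ := lt_neg_of_wall_pos u₁ ρ ((u₁ ^ 2 + u₂ ^ 2 + u₃ ^ 2 + u₄ ^ 2 + u₅ ^ 2) - (v₁ ^ 2 + v₂ ^ 2 + v₃ ^ 2)) hρ2 hw₁ hu1
        have hu4' : ρ < u₄ := gt_of_wall_pos u₄ ρ ((u₁ ^ 2 + u₂ ^ 2 + u₃ ^ 2 + u₄ ^ 2 + u₅ ^ 2) - (v₁ ^ 2 + v₂ ^ 2 + v₃ ^ 2)) hρ2 hw₄ hu4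
        have hz₁ : 0 < (v₁ ^ 2 - ((u₁ ^ 2 + u₂ ^ 2 + u₃ ^ 2 + u₄ ^ 2 + u₅ ^ 2) - (v₁ ^ 2 + v₂ ^ 2 + v₃ ^ 2)) / 2) := wall_pos_of_lt_neg v₁ ρ ((u₁ ^ 2 + u₂ ^ 2 + u₃ ^ 2 + u₄ ^ 2 + u₅ ^ 2) - (v₁ ^ 2 + v₂ ^ 2 + v₃ ^ 2)) hρ hρ2 (by linarith only [h₁, hu1'])
        have hz₂ : 0 < (v₂ ^ 2 - ((u₁ ^ 2 + u₂ ^ 2 + u₃ ^ 2 + u₄ ^ 2 + u₅ ^ 2) - (v₁ ^ 2 + v₂ ^ 2 + v₃ ^ 2)) / 2) := wall_pos_of_gt v₂ ρ ((u₁ ^ 2 + u₂ ^ 2 + u₃ ^ 2 + u₄ ^ 2 + u₅ ^ 2) - (v₁ ^ 2 + v₂ ^ 2 + v₃ ^ 2)) hρ hρ2 (by linarith only [hu4', h₄])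
        have hz₃ : 0 < (v₃ ^ 2 - ((u₁ ^ 2 + u₂ ^ 2 + u₃ ^ 2 + u₄ ^ 2 + u₅ ^ 2) - (v₁ ^ 2 + v₂ ^ 2 + v₃ ^ 2)) / 2) := wall_pos_of_gt v₃ ρ ((u₁ ^ 2 + u₂ ^ 2 + u₃ ^ 2 + u₄ ^ 2 + u₅ ^ 2) - (v₁ ^ 2 + v₂ ^ 2 + v₃ ^ 2)) hρ hρ2 (by linarith only [hu4', h₄, hv₂₃])
        have hw₅ : 0 < (u₅ ^ 2 - ((u₁ ^ 2 + u₂ ^ 2 + u₃ ^ 2 + u₄ ^ 2 + u₅ ^ 2) - (v₁ ^ 2 + v₂ ^ 2 + v₃ ^ 2)) / 2) := wall_pos_of_gt u₅ ρ ((u₁ ^ 2 + u₂ ^ 2 + u₃ ^ 2 + u₄ ^ 2 + u₅ ^ 2) - (v₁ ^ 2 + v₂ ^ 2 + v₃ ^ 2)) hρ hρ2 (by linarith only [hu4', h₄, hv₂₃, h₅])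
        exact no_config_of_walls_pos A₁ A₂ A₃ A₄ A₅ B₁ B₂ B₃ u₁ u₂ u₃ u₄ u₅ v₁ v₂ v₃ hA hP2 m₁₁ m₂₁ m₃₁ m₄₁ m₅₁ m₁₂ m₂₂ m₃₂ m₄₂ m₅₂ m₁₃ m₂₃ m₃₃ m₄₃ m₅₃ hw₁ hw₂ hw₃ hw₄ hw₅ hz₁ hz₂ hz₃

/-- REAL CONJECTURE N ON THE PATTERN (0,4,4), every `λ ≥ 0`: sorted charges `v₁ < u₁ ≤ u₂ ≤ u₃ ≤ u₄ < v₂ ≤ v₃ < u₅`; either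
`Q₄ ≥ 0` (pv2-g15's `conjectureN_53_of_Q4_nonneg`) or the configuration does not exist (`no_config_044_of_Q4_neg`). -/
theorem Glam_nonneg_044 (A₁ A₂ A₃ A₄ A₅ B₁ B₂ B₃ u₁ u₂ u₃ u₄ u₅ v₁ v₂ v₃ : ℝ)
    (hA : A₁ + A₂ + A₃ + A₄ + A₅ = B₁ + B₂ + B₃) (hC : u₁ + u₂ + u₃ + u₄ + u₅ = v₁ + v₂ + v₃)
    (hP1 : (A₁ ^ 2 * u₁ + A₂ ^ 2 * u₂ + A₃ ^ 2 * u₃ + A₄ ^ 2 * u₄ + A₅ ^ 2 * u₅) - (B₁ ^ 2 * v₁ + B₂ ^ 2 * v₂ + B₃ ^ 2 * v₃) = 0)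
    (hP2 : (A₁ * u₁ ^ 2 + A₂ * u₂ ^ 2 + A₃ * u₃ ^ 2 + A₄ * u₄ ^ 2 + A₅ * u₅ ^ 2) - (B₁ * v₁ ^ 2 + B₂ * v₂ ^ 2 + B₃ * v₃ ^ 2) = 0)
    (hP4 : (u₁ ^ 3 + u₂ ^ 3 + u₃ ^ 3 + u₄ ^ 3 + u₅ ^ 3) - (v₁ ^ 3 + v₂ ^ 3 + v₃ ^ 3) = 0)
    (m₁₁ : |u₁ - v₁| ≤ A₁ - B₁) (m₂₁ : |u₂ - v₁| ≤ A₂ - B₁) (m₃₁ : |u₃ - v₁| ≤ A₃ - B₁) (m₄₁ : |u₄ - v₁| ≤ A₄ - B₁) (m₅₁ : |u₅ - v₁| ≤ A₅ - B₁)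
    (m₁₂ : |u₁ - v₂| ≤ A₁ - B₂) (m₂₂ : |u₂ - v₂| ≤ A₂ - B₂) (m₃₂ : |u₃ - v₂| ≤ A₃ - B₂) (m₄₂ : |u₄ - v₂| ≤ A₄ - B₂) (m₅₂ : |u₅ - v₂| ≤ A₅ - B₂)
    (m₁₃ : |u₁ - v₃| ≤ A₁ - B₃) (m₂₃ : |u₂ - v₃| ≤ A₂ - B₃) (m₃₃ : |u₃ - v₃| ≤ A₃ - B₃) (m₄₃ : |u₄ - v₃| ≤ A₄ - B₃) (m₅₃ : |u₅ - v₃| ≤ A₅ - B₃)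
    (h₁ : v₁ < u₁) (h₁₂ : u₁ ≤ u₂) (h₂₃ : u₂ ≤ u₃) (h₃₄ : u₃ ≤ u₄) (h₄ : u₄ < v₂) (hv₂₃ : v₂ ≤ v₃) (h₅ : v₃ < u₅)
    (l : ℝ) (hl : 0 ≤ l) :
    0 ≤ (1 / 2) * ((A₁ ^ 2 + A₂ ^ 2 + A₃ ^ 2 + A₄ ^ 2 + A₅ ^ 2) - (B₁ ^ 2 + B₂ ^ 2 + B₃ ^ 2)) * ((u₁ ^ 2 + u₂ ^ 2 + u₃ ^ 2 + u₄ ^ 2 + u₅ ^ 2) - (v₁ ^ 2 + v₂ ^ 2 + v₃ ^ 2))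
        + ((A₁ * u₁ + A₂ * u₂ + A₃ * u₃ + A₄ * u₄ + A₅ * u₅) - (B₁ * v₁ + B₂ * v₂ + B₃ * v₃)) ^ 2
        - 3 * ((A₁ ^ 2 * u₁ ^ 2 + A₂ ^ 2 * u₂ ^ 2 + A₃ ^ 2 * u₃ ^ 2 + A₄ ^ 2 * u₄ ^ 2 + A₅ ^ 2 * u₅ ^ 2) - (B₁ ^ 2 * v₁ ^ 2 + B₂ ^ 2 * v₂ ^ 2 + B₃ ^ 2 * v₃ ^ 2))
      + l * (3 * ((u₁ ^ 4 + u₂ ^ 4 + u₃ ^ 4 + u₄ ^ 4 + u₅ ^ 4) - (v₁ ^ 4 + v₂ ^ 4 + v₃ ^ 4)) - (3 / 2) * ((u₁ ^ 2 + u₂ ^ 2 + u₃ ^ 2 + u₄ ^ 2 + u₅ ^ 2) - (v₁ ^ 2 + v₂ ^ 2 + v₃ ^ 2)) ^ 2) := by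
  rcases le_or_gt 0 (3 * ((u₁ ^ 4 + u₂ ^ 4 + u₃ ^ 4 + u₄ ^ 4 + u₅ ^ 4) - (v₁ ^ 4 + v₂ ^ 4 + v₃ ^ 4)) - (3 / 2) * ((u₁ ^ 2 + u₂ ^ 2 + u₃ ^ 2 + u₄ ^ 2 + u₅ ^ 2) - (v₁ ^ 2 + v₂ ^ 2 + v₃ ^ 2)) ^ 2) with hQ | hQ
  · exact conjectureN_53_of_Q4_nonneg A₁ A₂ A₃ A₄ A₅ B₁ B₂ B₃ u₁ u₂ u₃ u₄ u₅ v₁ v₂ v₃ hA hC hP1 hP2 m₁₁ m₂₁ m₃₁ m₄₁ m₅₁ m₁₂ m₂₂ m₃₂ m₄₂ m₅₂ m₁₃ m₂₃ m₃₃ m₄₃ m₅₃ hQ l hl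
  · exact (no_config_044_of_Q4_neg A₁ A₂ A₃ A₄ A₅ B₁ B₂ B₃ u₁ u₂ u₃ u₄ u₅ v₁ v₂ v₃ hA hC hP2 hP4 m₁₁ m₂₁ m₃₁ m₄₁ m₅₁ m₁₂ m₂₂ m₃₂ m₄₂ m₅₂ m₁₃ m₂₃ m₃₃ m₄₃ m₅₃ h₁ h₁₂ h₂₃ h₃₄ h₄ hv₂₃ h₅ hQ).elim

set_option maxHeartbeats 800000 in
/-- REAL CONJECTURE N ON THE PATTERN (1,1,5), every `λ ≥ 0` (mirror of `Glam_nonneg_044` under `u ↦ −u`, `v ↦ −v`): sorted charges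
`u₁ < v₁ ≤ v₂ < u₂ ≤ u₃ ≤ u₄ ≤ u₅ < v₃`. -/
theorem Glam_nonneg_115 (A₁ A₂ A₃ A₄ A₅ B₁ B₂ B₃ u₁ u₂ u₃ u₄ u₅ v₁ v₂ v₃ : ℝ)
    (hA : A₁ + A₂ + A₃ + A₄ + A₅ = B₁ + B₂ + B₃) (hC : u₁ + u₂ + u₃ + u₄ + u₅ = v₁ + v₂ + v₃)
    (hP1 : (A₁ ^ 2 * u₁ + A₂ ^ 2 * u₂ + A₃ ^ 2 * u₃ + A₄ ^ 2 * u₄ + A₅ ^ 2 * u₅) - (B₁ ^ 2 * v₁ + B₂ ^ 2 * v₂ + B₃ ^ 2 * v₃) = 0)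
    (hP2 : (A₁ * u₁ ^ 2 + A₂ * u₂ ^ 2 + A₃ * u₃ ^ 2 + A₄ * u₄ ^ 2 + A₅ * u₅ ^ 2) - (B₁ * v₁ ^ 2 + B₂ * v₂ ^ 2 + B₃ * v₃ ^ 2) = 0)
    (hP4 : (u₁ ^ 3 + u₂ ^ 3 + u₃ ^ 3 + u₄ ^ 3 + u₅ ^ 3) - (v₁ ^ 3 + v₂ ^ 3 + v₃ ^ 3) = 0)
    (m₁₁ : |u₁ - v₁| ≤ A₁ - B₁) (m₂₁ : |u₂ - v₁| ≤ A₂ - B₁) (m₃₁ : |u₃ - v₁| ≤ A₃ - B₁) (m₄₁ : |u₄ - v₁| ≤ A₄ - B₁) (m₅₁ : |u₅ - v₁| ≤ A₅ - B₁)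
    (m₁₂ : |u₁ - v₂| ≤ A₁ - B₂) (m₂₂ : |u₂ - v₂| ≤ A₂ - B₂) (m₃₂ : |u₃ - v₂| ≤ A₃ - B₂) (m₄₂ : |u₄ - v₂| ≤ A₄ - B₂) (m₅₂ : |u₅ - v₂| ≤ A₅ - B₂)
    (m₁₃ : |u₁ - v₃| ≤ A₁ - B₃) (m₂₃ : |u₂ - v₃| ≤ A₂ - B₃) (m₃₃ : |u₃ - v₃| ≤ A₃ - B₃) (m₄₃ : |u₄ - v₃| ≤ A₄ - B₃) (m₅₃ : |u₅ - v₃| ≤ A₅ - B₃)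
    (h₁ : u₁ < v₁) (hv₁₂ : v₁ ≤ v₂) (h₂ : v₂ < u₂) (h₂₃ : u₂ ≤ u₃) (h₃₄ : u₃ ≤ u₄) (h₄₅ : u₄ ≤ u₅) (h₅ : u₅ < v₃)
    (l : ℝ) (hl : 0 ≤ l) :
    0 ≤ (1 / 2) * ((A₁ ^ 2 + A₂ ^ 2 + A₃ ^ 2 + A₄ ^ 2 + A₅ ^ 2) - (B₁ ^ 2 + B₂ ^ 2 + B₃ ^ 2)) * ((u₁ ^ 2 + u₂ ^ 2 + u₃ ^ 2 + u₄ ^ 2 + u₅ ^ 2) - (v₁ ^ 2 + v₂ ^ 2 + v₃ ^ 2))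
        + ((A₁ * u₁ + A₂ * u₂ + A₃ * u₃ + A₄ * u₄ + A₅ * u₅) - (B₁ * v₁ + B₂ * v₂ + B₃ * v₃)) ^ 2
        - 3 * ((A₁ ^ 2 * u₁ ^ 2 + A₂ ^ 2 * u₂ ^ 2 + A₃ ^ 2 * u₃ ^ 2 + A₄ ^ 2 * u₄ ^ 2 + A₅ ^ 2 * u₅ ^ 2) - (B₁ ^ 2 * v₁ ^ 2 + B₂ ^ 2 * v₂ ^ 2 + B₃ ^ 2 * v₃ ^ 2))
      + l * (3 * ((u₁ ^ 4 + u₂ ^ 4 + u₃ ^ 4 + u₄ ^ 4 + u₅ ^ 4) - (v₁ ^ 4 + v₂ ^ 4 + v₃ ^ 4)) - (3 / 2) * ((u₁ ^ 2 + u₂ ^ 2 + u₃ ^ 2 + u₄ ^ 2 + u₅ ^ 2) - (v₁ ^ 2 + v₂ ^ 2 + v₃ ^ 2)) ^ 2) := by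
  have key := Glam_nonneg_044 A₅ A₄ A₃ A₂ A₁ B₃ B₂ B₁ (-u₅) (-u₄) (-u₃) (-u₂) (-u₁) (-v₃) (-v₂) (-v₁)
      (by linarith) (by linarith) (by linear_combination (-1 : ℝ) * hP1) (by linear_combination hP2)
      (by linear_combination (-1 : ℝ) * hP4)
      (by rw [show (-u₅) - (-v₃) = -(u₅ - v₃) by ring, abs_neg]; exact m₅₃)
      (by rw [show (-u₄) - (-v₃) = -(u₄ - v₃) by ring, abs_neg]; exact m₄₃)
      (by rw [show (-u₃) - (-v₃) = -(u₃ - v₃) by ring, abs_neg]; exact m₃₃)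
      (by rw [show (-u₂) - (-v₃) = -(u₂ - v₃) by ring, abs_neg]; exact m₂₃)
      (by rw [show (-u₁) - (-v₃) = -(u₁ - v₃) by ring, abs_neg]; exact m₁₃)
      (by rw [show (-u₅) - (-v₂) = -(u₅ - v₂) by ring, abs_neg]; exact m₅₂)
      (by rw [show (-u₄) - (-v₂) = -(u₄ - v₂) by ring, abs_neg]; exact m₄₂)
      (by rw [show (-u₃) - (-v₂) = -(u₃ - v₂) by ring, abs_neg]; exact m₃₂)
      (by rw [show (-u₂) - (-v₂) = -(u₂ - v₂) by ring, abs_neg]; exact m₂₂)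
      (by rw [show (-u₁) - (-v₂) = -(u₁ - v₂) by ring, abs_neg]; exact m₁₂)
      (by rw [show (-u₅) - (-v₁) = -(u₅ - v₁) by ring, abs_neg]; exact m₅₁)
      (by rw [show (-u₄) - (-v₁) = -(u₄ - v₁) by ring, abs_neg]; exact m₄₁)
      (by rw [show (-u₃) - (-v₁) = -(u₃ - v₁) by ring, abs_neg]; exact m₃₁)
      (by rw [show (-u₂) - (-v₁) = -(u₂ - v₁) by ring, abs_neg]; exact m₂₁)
      (by rw [show (-u₁) - (-v₁) = -(u₁ - v₁) by ring, abs_neg]; exact m₁₁)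
      (by linarith) (by linarith) (by linarith) (by linarith) (by linarith) (by linarith) (by linarith) l hl
  have e : (1 / 2) * ((A₁ ^ 2 + A₂ ^ 2 + A₃ ^ 2 + A₄ ^ 2 + A₅ ^ 2) - (B₁ ^ 2 + B₂ ^ 2 + B₃ ^ 2)) * ((u₁ ^ 2 + u₂ ^ 2 + u₃ ^ 2 + u₄ ^ 2 + u₅ ^ 2) - (v₁ ^ 2 + v₂ ^ 2 + v₃ ^ 2))
        + ((A₁ * u₁ + A₂ * u₂ + A₃ * u₃ + A₄ * u₄ + A₅ * u₅) - (B₁ * v₁ + B₂ * v₂ + B₃ * v₃)) ^ 2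
        - 3 * ((A₁ ^ 2 * u₁ ^ 2 + A₂ ^ 2 * u₂ ^ 2 + A₃ ^ 2 * u₃ ^ 2 + A₄ ^ 2 * u₄ ^ 2 + A₅ ^ 2 * u₅ ^ 2) - (B₁ ^ 2 * v₁ ^ 2 + B₂ ^ 2 * v₂ ^ 2 + B₃ ^ 2 * v₃ ^ 2))
      + l * (3 * ((u₁ ^ 4 + u₂ ^ 4 + u₃ ^ 4 + u₄ ^ 4 + u₅ ^ 4) - (v₁ ^ 4 + v₂ ^ 4 + v₃ ^ 4)) - (3 / 2) * ((u₁ ^ 2 + u₂ ^ 2 + u₃ ^ 2 + u₄ ^ 2 + u₅ ^ 2) - (v₁ ^ 2 + v₂ ^ 2 + v₃ ^ 2)) ^ 2)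
      = (1 / 2) * ((A₅ ^ 2 + A₄ ^ 2 + A₃ ^ 2 + A₂ ^ 2 + A₁ ^ 2) - (B₃ ^ 2 + B₂ ^ 2 + B₁ ^ 2)) * (((-u₅) ^ 2 + (-u₄) ^ 2 + (-u₃) ^ 2 + (-u₂) ^ 2 + (-u₁) ^ 2) - ((-v₃) ^ 2 + (-v₂) ^ 2 + (-v₁) ^ 2))
        + ((A₅ * (-u₅) + A₄ * (-u₄) + A₃ * (-u₃) + A₂ * (-u₂) + A₁ * (-u₁)) - (B₃ * (-v₃) + B₂ * (-v₂) + B₁ * (-v₁))) ^ 2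
        - 3 * ((A₅ ^ 2 * (-u₅) ^ 2 + A₄ ^ 2 * (-u₄) ^ 2 + A₃ ^ 2 * (-u₃) ^ 2 + A₂ ^ 2 * (-u₂) ^ 2 + A₁ ^ 2 * (-u₁) ^ 2) - (B₃ ^ 2 * (-v₃) ^ 2 + B₂ ^ 2 * (-v₂) ^ 2 + B₁ ^ 2 * (-v₁) ^ 2))
      + l * (3 * (((-u₅) ^ 4 + (-u₄) ^ 4 + (-u₃) ^ 4 + (-u₂) ^ 4 + (-u₁) ^ 4) - ((-v₃) ^ 4 + (-v₂) ^ 4 + (-v₁) ^ 4)) - (3 / 2) * (((-u₅) ^ 2 + (-u₄) ^ 2 + (-u₃) ^ 2 + (-u₂) ^ 2 + (-u₁) ^ 2) - ((-v₃) ^ 2 + (-v₂) ^ 2 + (-v₁) ^ 2)) ^ 2) := by ring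
  rw [e]; exact key

end Summit.HodgeConjecture.HodgeConjecture.WeilClassTestFormatFiveThreePattern044
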